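import Summits.ResolutionOfSingularities.ResolutionOfSingularities.Theorems.FrobeniusLadderFRationalResolutionRungsIff
import Summits.ResolutionOfSingularities.ResolutionOfSingularities.Theorems.FrobeniusLadderFRationalResolutionModelNormal
import Literature.AlgebraicGeometry.Resolution.SurfaceResolutionReduction
import Literature.AlgebraicGeometry.Resolution.QuasiProjectiveResolution
import Mathlib.AlgebraicGeometry.Morphisms.Proper
import HarnessLib

/-!
# Crux `FRationalResolution` in dimension `≤ 3`: what the tree's named facts give (conditionally)

Route `FrobeniusLadder`, crux stmt-ResolutionOfSingularities-15317, line `Sketch`. Together with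
`FrobeniusLadderFRationalResolutionDimLeOne.lean` (dimension `≤ 1`, UNCONDITIONAL) this file fixes
inside Lean where the open content of the crux begins:

* `hasResolution_of_fRational_model_of_dim_le_three` — modulo the named fact
  `Literature.AlgebraicGeometry.Resolution.CossartPiltant2019` (resolution of reduced separated
  finite-type schemes of dimension `≤ 3` over any field), every separated finite-type `X/k` with an
  F-rational proper birational model of dimension `≤ 3` has a resolution. F-rationality enters only
  through "domain stalks ⇒ reduced model"; the named fact does the work.
* `hasResolution_of_fRational_model_of_dim_two` — modulo `CossartJannsenSaito2020` in its
  normal-surface form (`cossartJannsenSaito2020_iff_normalSurfaces`: resolution of INTEGRAL NORMAL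
  surfaces of finite type over a field), every such `X` with an INTEGRAL F-rational model of
  dimension `2` has a resolution; here F-rationality supplies normality of the model
  (Hochster–Huneke 1994 Thm. 4.2 (b), `isIntegrallyClosed_stalk_of_fRational_clause`).

Both are CONDITIONAL results (the gate records them as such); the unconditional open core of the
crux is therefore "integral F-rational `X/k` of dimension `≥ 2`", and modulo Cossart–Piltant it is
"dimension `≥ 4`" — exactly the summit's own frontier restricted to the residual class.
-/

-- single-problem summit: the doubled namespace component `ResolutionOfSingularities` is forced
set_option linter.dupNamespace false

noncomputable section

open CategoryTheory AlgebraicGeometry TopologicalSpace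
open Literature.AlgebraicGeometry.Resolution

namespace Summit.ResolutionOfSingularities.ResolutionOfSingularities.Theorems.FRationalResolution

/-- **The crux in dimension `≤ 3`, modulo Cossart–Piltant 2019.** If `X/k` (char `p`) is
separated of finite type and admits a proper birational model `X' → X` of dimension `≤ 3` whose
stalks satisfy the F-rational clause, then `X` has a resolution: `X'` is reduced (domain stalks),
separated and of finite type over `k` through `π ≫ f`, so `CossartPiltant2019` resolves `X'`, and
resolutions transport along `π` (`Scheme.HasResolution.of_isBirational`). -/
theorem hasResolution_of_fRational_model_of_dim_le_three (hCP : CossartPiltant2019.{0}) (p : ℕ)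
    (k : Type) [Field k] [CharP k p] (X : Scheme.{0}) (f : X ⟶ Spec (.of k))
    [IsSeparated f] [LocallyOfFiniteType f] [QuasiCompact f]
    (hmodel : ∃ (X' : Scheme.{0}) (π : X' ⟶ X), IsProper π ∧ IsBirational π ∧
      topologicalKrullDim X' ≤ 3 ∧
      ∀ x : X', IsDomain (X'.presheaf.stalk x) ∧ ∀ d : ℕ, ringKrullDim (X'.presheaf.stalk x) = d →
        ∀ s : Fin d → X'.presheaf.stalk x, (Ideal.span (Set.range s)).radical.IsMaximal →
        ∀ y c : X'.presheaf.stalk x, c ≠ 0 →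
        (∀ e : ℕ, c * y ^ p ^ e ∈ Ideal.span ((fun z : X'.presheaf.stalk x => z ^ p ^ e) ''
          (Ideal.span (Set.range s) : Set (X'.presheaf.stalk x)))) → y ∈ Ideal.span (Set.range s)) :
    Scheme.HasResolution X := by
  obtain ⟨X', π, hπ, hbir, hdim, hFR⟩ := hmodel
  haveI := hπ
  haveI : IsReduced X' := isReduced_of_isDomain_stalk X' fun x => (hFR x).1
  exact Scheme.HasResolution.of_isBirational π hbir
    (hasResolution_of_dim_le_three hCP (p := p) k X' (π ≫ f) hdim)

/-- **The crux for integral models of dimension `2`, modulo Cossart–Jannsen–Saito 2020 (normal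
surfaces).** If `X/k` (char `p` prime) is separated of finite type and admits a proper birational
INTEGRAL model `X' → X` of dimension `2` whose stalks satisfy the F-rational clause, then `X` has a
resolution: the model is normal (F-rational ⇒ normal, Hochster–Huneke 1994 Thm. 4.2 (b)), so the
normal-surface form of `CossartJannsenSaito2020` resolves it, and resolutions transport along `π`. -/
theorem hasResolution_of_fRational_model_of_dim_two (hCJS : CossartJannsenSaito2020.{0}) (p : ℕ)
    (hp : p.Prime) (k : Type) [Field k] [CharP k p] (X : Scheme.{0}) (f : X ⟶ Spec (.of k))
    [IsSeparated f] [LocallyOfFiniteType f] [QuasiCompact f]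
    (hmodel : ∃ (X' : Scheme.{0}) (π : X' ⟶ X), IsProper π ∧ IsBirational π ∧ IsIntegral X' ∧
      topologicalKrullDim X' = 2 ∧
      ∀ x : X', IsDomain (X'.presheaf.stalk x) ∧ ∀ d : ℕ, ringKrullDim (X'.presheaf.stalk x) = d →
        ∀ s : Fin d → X'.presheaf.stalk x, (Ideal.span (Set.range s)).radical.IsMaximal →
        ∀ y c : X'.presheaf.stalk x, c ≠ 0 →
        (∀ e : ℕ, c * y ^ p ^ e ∈ Ideal.span ((fun z : X'.presheaf.stalk x => z ^ p ^ e) ''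
          (Ideal.span (Set.range s) : Set (X'.presheaf.stalk x)))) → y ∈ Ideal.span (Set.range s)) :
    Scheme.HasResolution X := by
  obtain ⟨X', π, hπ, hbir, hint, hdim, hFR⟩ := hmodel
  haveI := hπ
  haveI := hint
  have hN : ∀ x : X', IsIntegrallyClosed (X'.presheaf.stalk x) :=
    isIntegrallyClosed_stalk_of_fRational_clause p hp k X' (π ≫ f) hFR
  exact Scheme.HasResolution.of_isBirational π hbir
    ((cossartJannsenSaito2020_iff_normalSurfaces.mp hCJS) k X' (π ≫ f) inferInstance inferInstance
      inferInstance hint hN hdim)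

end Summit.ResolutionOfSingularities.ResolutionOfSingularities.Theorems.FRationalResolution

end
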